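import Summits.QuantumAdvantage.QuantumAdvantage.Theorems.CubicForrelationNearExactIsExactFourModSixDigits
import Summits.QuantumAdvantage.QuantumAdvantage.Theorems.CubicForrelationNearExactIsExactSixteenResidual
import Summits.QuantumAdvantage.QuantumAdvantage.Theorems.CubicForrelationNearExactIsExactZeroModSixDigits

/-!
# Crux `CubicForrelation.NearExactIsExact` (stmt-QuantumAdvantage-14043) — the RESIDUAL split configuration on `n = 6r+4` bits is empty
  (general `r`; the tiling-parity heart of the second-boundary analysis on `n ≡ 4 (mod 6)`)

Certificate seat `b2b-cforr-cert` (gen 8).  HONEST FRAMING: a theorem uniform in `r` about cubic Boolean functions on `6r+4` bits — a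
preparatory verdict toward `θ_n < 1 − 2^{−⌊n/3⌋}` for `n ≡ 4 (mod 6)`; NOT summit progress.

For a cubic `g : 𝔽₂^{(3r+2)+(3r+2)} → 𝔽₂` write `W_g = 2^{2r+2}u` and `d₀, d₁, d₂` for the Euclidean binary digits of `u` (degrees `≤ 1, 2, 4`,
`…FourModSixDigits`).  For `r ≥ 3` (where `2^r ≡ 0 (mod 8)`) the two-sided budget analysis at `Φ ≥ 1 − 2^{−(2r+1)}` leaves, in the split case,
the RESIDUAL configuration: the parity `d₀` is a NON-CONSTANT affine function and
* off its support (`u` even): `u ≡ 0 (mod 8)` (`d₁ = d₂ = 0`);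
* on its support (`u` odd): `u ≡ ±1 (mod 8)` (`d₂ = d₁`).
THEOREM `f2_residual_false`: no cubic `g` on `6r+4` bits is in this configuration (every `r ≥ 1`).  The proof is the tree's `n = 16` theorem
`sx_residual_false` (`…SixteenResidual.lean`, residual `u ≡ 4 (8)` / `u ≡ ±3 (8)` there) in general `r`, with the pointwise congruence
`u ≡ d₀ + 6d₁ (mod 8)`:
1. FLIP: `d₀ = (−1)^b(−1)^{c·x}` with `c ≠ 0`; `t = e_i` with `c_i = 1` swaps the halves.
2. STRUCTURE: `d₁ = d₀ ∧ α`, `α := D_t d₁` affine, so on every `4`-cube `#{d₁} ≡ 0 (mod 4)`, `#{d₀} ≡ 0 (mod 8)`, `Σ_{E_I} u ≡ 0 (mod 8)`.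
3. TILINGS: Poisson over `E_I` + the saturated congruence on the `6r`-cube `E_{Iᶜ}` give `Σ_{E_I} u = 4·N_{2r}(Iᶜ) + 8k`, so `N_{2r}(Iᶜ)` is
   EVEN for every `4`-set `I`; Poisson over `E_{{i}}` and the `(6r+3)`-cube give `u(0) + u(e_i) ≡ N_{2r+1}({i}ᶜ) (mod 2)` with the left side
   ODD by the flip, while `N_{2r+1}({i}ᶜ) = Σ_{s₀ ∋ j} N_{2r}({i}ᶜ ∖ supp s₀)` is even. Contradiction.

References: J. Ax (1964) / R. J. McEliece (1972) (Carlet 2021 §4.1); MacWilliams–Sloane Ch. 13–15.  Everything below is proved from Mathlib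
and the tree; axioms are the standard three.
-/

set_option linter.dupNamespace false -- D-0017: single-problem summit ⇒ `QuantumAdvantage.QuantumAdvantage` by design

noncomputable section

namespace Summit.QuantumAdvantage.QuantumAdvantage.Theorems.CubicForrelation.NearExactIsExact

open Finset
open Literature.Computability.QuantumComplexity
open Literature.Computability.QuantumComplexity.BuzetChailloux (bxor zeroVec)
open Literature.Computability.QuantumComplexity.DerivativeWalsh (W)
open Summit.QuantumAdvantage.QuantumAdvantage.Theorems.SignedExactCubicForrelationNotPrBPP (eq_of_signOf_eq)

/-! ### General-`n` tools -/

/-- **Conjunctions of two affine functions on a `4`-cube** (any `n`). For `P, Q` of degree `≤ 1` and `|I| = 4`, the number of points of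
the coordinate cube `E_I` with `P ∧ Q` is a multiple of `4`. [this work] -/
theorem f2_count_and_affine {n : ℕ} (P Q : (Fin n → Bool) → Bool) (hP : IsDegLeFun 1 P) (hQ : IsDegLeFun 1 Q)
    (I : Finset (Fin n)) (hI : #I = 4) :
    ∃ w : ℤ, (#{x : Fin n → Bool | (∀ i, x i = true → i ∈ I) ∧ (P x && Q x) = true} : ℤ) = 4 * w := by
  obtain ⟨z₁, hz₁⟩ := stub_axParity n 1 P I le_rfl hP
  obtain ⟨z₂, hz₂⟩ := stub_axParity n 1 Q I le_rfl hQ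
  obtain ⟨z₃, hz₃⟩ := stub_axParity n 1 (fun x => P x ^^ Q x) I le_rfl (bb_isDegLeFun_bxor hP hQ)
  rw [hI, show (4 + 1 - 1) / 1 = 4 by norm_num] at hz₁ hz₂ hz₃
  refine ⟨1 - z₁ - z₂ + z₃, ?_⟩
  have hcard : ((#{x : Fin n → Bool | (∀ i, x i = true → i ∈ I) ∧ (P x && Q x) = true} : ℤ) : ℝ) =
      ∑ x ∈ {x : Fin n → Bool | ∀ i, x i = true → i ∈ I}, (if (P x && Q x) = true then (1 : ℝ) else 0) := by
    rw [sum_boole, filter_filter]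
    push_cast
    rfl
  have hE : ((#({x : Fin n → Bool | ∀ i, x i = true → i ∈ I} : Finset _) : ℕ) : ℝ) = 16 := by
    rw [bb_card_cube I, hI]
    norm_num
  have key : ((#{x : Fin n → Bool | (∀ i, x i = true → i ∈ I) ∧ (P x && Q x) = true} : ℤ) : ℝ) =
      ((4 * (1 - z₁ - z₂ + z₃) : ℤ) : ℝ) := by
    rw [hcard, sum_congr rfl fun x _ => sx_ite_and_eq_signs (P x) (Q x), ← sum_div, sum_add_distrib, sum_sub_distrib,
      sum_sub_distrib, sum_const, nsmul_eq_mul, mul_one, hE, hz₁, hz₂, hz₃]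
    push_cast
    ring
  exact_mod_cast key

/-- The one-dimensional coordinate cube `E_{{i}}` is the pair `{0, e_i}` (any `n`). [folklore] -/
theorem f2_cube_singleton {n : ℕ} (i : Fin n) :
    ({x : Fin n → Bool | ∀ j, x j = true → j ∈ ({i} : Finset (Fin n))} : Finset _) = {zeroVec, fun j => decide (j = i)} := by
  ext x
  simp only [mem_filter, mem_univ, true_and, mem_singleton, mem_insert]
  constructor
  · intro h
    by_cases hxi : x i = true
    · right
      funext j
      by_cases hji : j = i
      · subst hji; simp [hxi]
      · have : x j = false := by
          cases hxj : x j
          · rfl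
          · exact absurd (h j hxj) hji
        simp [hji, this]
    · left
      funext j
      cases hxj : x j
      · rfl
      · have hji := h j hxj
        subst hji
        exact absurd hxj hxi
  · rintro (rfl | rfl) j hj
    · exact absurd hj (by simp [zeroVec])
    · simpa using hj

section Residual

variable (r : ℕ) (g : (Fin ((3 * r + 2) + (3 * r + 2)) → Bool) → Bool) (u : (Fin ((3 * r + 2) + (3 * r + 2)) → Bool) → ℤ)

/-! ### Step 1: the flip across the split -/

/-- **The flip.** If the Ax-level parity of a cubic `g` on `6r+4` bits takes both values, there is a coordinate vector `e_i` across the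
split: `u(x ⊕ e_i)` is odd exactly when `u(x)` is even. [this work] -/
theorem f2_exists_flip (hg : IsDegLeFun 3 g) (hu : ∀ x, W (fun y => signOf (g y)) x = (2 : ℝ) ^ (2 * r + 2) * (u x : ℝ))
    (hodd : ∃ x, Odd (u x)) (heven : ∃ x, ¬ Odd (u x)) :
    ∃ i : Fin ((3 * r + 2) + (3 * r + 2)), ∀ x, Odd (u (bxor x (fun j => decide (j = i)))) ↔ ¬ Odd (u x) := by
  obtain ⟨c, b, hc⟩ := stub_affineForm ((3 * r + 2) + (3 * r + 2)) (fun x => decide (Odd (u x))) (f2_digitZero r g u hg hu)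
  have hci : ∃ i, c i = true := by
    by_contra hnone
    push Not at hnone
    have hc0 : ∀ x, twist c x = 1 := fun x => by
      unfold twist
      exact prod_eq_one fun l _ => by simp [hnone l]
    obtain ⟨x₁, hx₁⟩ := hodd
    obtain ⟨x₂, hx₂⟩ := heven
    have h1 := hc x₁
    have h2 := hc x₂
    rw [hc0, mul_one] at h1 h2
    have e := eq_of_signOf_eq (h1.trans h2.symm)
    rw [decide_eq_true hx₁, decide_eq_false hx₂] at e
    exact Bool.noConfusion e
  obtain ⟨i, hi⟩ := hci
  refine ⟨i, fun x => ?_⟩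
  have ht : twist c (fun j => decide (j = i)) = -1 := by
    rw [twist_comm, tb_twist_single, hi]
    simp [signOf]
  have h := hc (bxor x (fun j => decide (j = i)))
  rw [BuzetChailloux.twist_bxor_right, ht, mul_neg_one, mul_neg, ← hc x] at h
  have e := sx_eq_not_of_signOf_eq_neg h
  by_cases hP : Odd (u (bxor x fun j => decide (j = i))) <;> by_cases hQ : Odd (u x) <;> simp [hP, hQ] at e ⊢

/-! ### Step 2: the structure `d₁ = d₀ ∧ α` and the residual cube congruence -/

/-- In the residual configuration the second digit factors through the flip: `d₁(x) = d₀(x) ∧ (d₁(x) ⊕ d₁(x ⊕ t))`. -/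
theorem f2_residual_digitOne_eq (t : Fin ((3 * r + 2) + (3 * r + 2)) → Bool)
    (hH : ∀ x, ¬ Odd (u x) → ¬ Odd (u x / 2) ∧ ¬ Odd (u x / 2 / 2))
    (hflip : ∀ x, Odd (u (bxor x t)) ↔ ¬ Odd (u x)) (x : Fin ((3 * r + 2) + (3 * r + 2)) → Bool) :
    decide (Odd (u x / 2)) =
      (decide (Odd (u x)) && (decide (Odd (u x / 2)) ^^ decide (Odd (u (bxor x t) / 2)))) := by
  by_cases h0 : Odd (u x)
  · have h1 : ¬ Odd (u (bxor x t) / 2) := (hH _ (fun h => (hflip x).1 h h0)).1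
    rw [decide_eq_true h0, decide_eq_false h1]
    cases decide (Odd (u x / 2)) <;> rfl
  · rw [decide_eq_false h0, decide_eq_false (hH x h0).1]
    rfl

/-- **Residual cube congruence.** In the residual configuration (`u ≡ 0 (8)` where `u` is even, `d₂ = d₁` where `u` is odd), for every
`4`-set `I`: `Σ_{x ∈ E_I} u(x) ≡ 0 (mod 8)` (`u ≡ d₀ + 6d₁ (mod 8)` pointwise; `#{d₀ on E_I} ≡ 0 (mod 8)`, `#{d₁ on E_I} ≡ 0 (mod 4)`).
[this work] -/
theorem f2_residual_cube_sum (hg : IsDegLeFun 3 g) (hu : ∀ x, W (fun y => signOf (g y)) x = (2 : ℝ) ^ (2 * r + 2) * (u x : ℝ))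
    (t : Fin ((3 * r + 2) + (3 * r + 2)) → Bool) (hH : ∀ x, ¬ Odd (u x) → ¬ Odd (u x / 2) ∧ ¬ Odd (u x / 2 / 2))
    (hL : ∀ x, Odd (u x) → (Odd (u x / 2) ↔ Odd (u x / 2 / 2)))
    (hflip : ∀ x, Odd (u (bxor x t)) ↔ ¬ Odd (u x)) (I : Finset (Fin ((3 * r + 2) + (3 * r + 2)))) (hI : #I = 4) :
    (8 : ℤ) ∣ ∑ x ∈ {x : Fin ((3 * r + 2) + (3 * r + 2)) → Bool | ∀ i, x i = true → i ∈ I}, u x := by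
  -- pointwise: `u = 8q + [u odd] + 6·[⌊u/2⌋ odd]`
  have hpt : ∀ x, ∃ q : ℤ, u x = 8 * q + (if Odd (u x) then 1 else 0) + 6 * (if Odd (u x / 2) then 1 else 0) := by
    intro x
    obtain ⟨q, hq⟩ := td_mod_eight (u x)
    by_cases h0 : Odd (u x)
    · have h12 := hL x h0
      refine ⟨q, ?_⟩
      rw [if_pos h0] at hq ⊢
      by_cases h1 : Odd (u x / 2)
      · rw [if_pos h1, if_pos (h12.1 h1)] at hq
        rw [if_pos h1]
        omega
      · rw [if_neg h1, if_neg (fun h => h1 (h12.2 h))] at hq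
        rw [if_neg h1]
        omega
    · obtain ⟨h1, h2⟩ := hH x h0
      refine ⟨q, ?_⟩
      rw [if_neg h0, if_neg h1, if_neg h2] at hq
      rw [if_neg h0, if_neg h1]
      omega
  choose q hq using hpt
  obtain ⟨z', hz'⟩ := td_count_cube (le_refl 1) (fun x => decide (Odd (u x))) (f2_digitZero r g u hg hu) I
  rw [hI, show (4 + 1 - 1) / 1 = 4 by norm_num] at hz'
  have hα : IsDegLeFun 1 (fun x => decide (Odd (u x / 2)) ^^ decide (Odd (u (bxor x t) / 2))) :=
    stub_derivDegree ((3 * r + 2) + (3 * r + 2)) 1 (fun x => decide (Odd (u x / 2))) t (f2_digitOne r g u hg hu)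
  obtain ⟨w, hw⟩ := f2_count_and_affine (fun x => decide (Odd (u x))) _ (f2_digitZero r g u hg hu) hα I hI
  have hset : (univ.filter fun x : Fin ((3 * r + 2) + (3 * r + 2)) → Bool => (∀ i, x i = true → i ∈ I) ∧ Odd (u x / 2)) =
      univ.filter fun x : Fin ((3 * r + 2) + (3 * r + 2)) → Bool => (∀ i, x i = true → i ∈ I) ∧
        (decide (Odd (u x)) && (decide (Odd (u x / 2)) ^^ decide (Odd (u (bxor x t) / 2)))) = true := by
    apply filter_congr
    intro x _
    rw [← f2_residual_digitOne_eq r u t hH hflip x, decide_eq_true_iff]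
  have hsum : ∑ x ∈ {x : Fin ((3 * r + 2) + (3 * r + 2)) → Bool | ∀ i, x i = true → i ∈ I}, u x =
      8 * ∑ x ∈ {x : Fin ((3 * r + 2) + (3 * r + 2)) → Bool | ∀ i, x i = true → i ∈ I}, q x +
        #{x : Fin ((3 * r + 2) + (3 * r + 2)) → Bool | (∀ i, x i = true → i ∈ I) ∧ decide (Odd (u x)) = true} +
        6 * #{x : Fin ((3 * r + 2) + (3 * r + 2)) → Bool | (∀ i, x i = true → i ∈ I) ∧ Odd (u x / 2)} := by
    rw [sum_congr rfl fun x _ => hq x, sum_add_distrib, sum_add_distrib, ← mul_sum, ← mul_sum, td_sum_ite_odd, td_sum_ite_odd,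
      filter_filter, filter_filter]
    simp only [decide_eq_true_eq]
  rw [hset] at hsum
  rw [hsum, hw]
  have e1 : (#{x : Fin ((3 * r + 2) + (3 * r + 2)) → Bool | (∀ i, x i = true → i ∈ I) ∧ decide (Odd (u x)) = true} : ℤ) =
      8 - 8 * z' := by
    linarith
  rw [e1]
  exact ⟨∑ x ∈ {x : Fin ((3 * r + 2) + (3 * r + 2)) → Bool | ∀ i, x i = true → i ∈ I}, q x + 1 - z' + 3 * w, by ring⟩

/-! ### Step 3: tiling parities and the contradiction -/

/-- **`N_{2r}` is even.** In the residual configuration, for every coordinate set `K` with `|Kᶜ| = 4` the number of sets of `2r` monomials of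
(a cubic polynomial representing) `g` whose supports tile `K` is even. [this work] -/
theorem f2_residual_N_even (hg : IsDegLeFun 3 g) (hu : ∀ x, W (fun y => signOf (g y)) x = (2 : ℝ) ^ (2 * r + 2) * (u x : ℝ))
    (p : MvPolynomial (Fin ((3 * r + 2) + (3 * r + 2))) (ZMod 2)) (hp : p.totalDegree ≤ 3) (hrep : ∀ x, g x = polyPhase p x)
    (t : Fin ((3 * r + 2) + (3 * r + 2)) → Bool) (hH : ∀ x, ¬ Odd (u x) → ¬ Odd (u x / 2) ∧ ¬ Odd (u x / 2 / 2))
    (hL : ∀ x, Odd (u x) → (Odd (u x / 2) ↔ Odd (u x / 2 / 2)))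
    (hflip : ∀ x, Odd (u (bxor x t)) ↔ ¬ Odd (u x)) (K : Finset (Fin ((3 * r + 2) + (3 * r + 2)))) (hK : #Kᶜ = 4) :
    Even #{S ∈ p.support.powerset | #S = 2 * r ∧ (S.biUnion fun s => s.support) = K} := by
  have hK3 : #K = 3 * (2 * r) := by
    have := card_compl K
    rw [Fintype.card_fin] at this
    omega
  have hP := bb_poisson (fun y => signOf (g y)) Kᶜ
  rw [sum_congr rfl fun x _ => hu x, ← mul_sum, compl_compl, hK, z2_bias_poly g p hrep K] at hP
  obtain ⟨k, hk⟩ := st_cube_bias_congr p hp K (2 * r) hK3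
  rw [hk] at hP
  set N := #{S ∈ p.support.powerset | #S = 2 * r ∧ (S.biUnion fun s => s.support) = K} with hN
  have hZ : (2 : ℤ) ^ (2 * r + 2) * ∑ x ∈ {x : Fin ((3 * r + 2) + (3 * r + 2)) → Bool | ∀ i, x i = true → i ∈ Kᶜ}, u x =
      2 ^ 4 * ((-2) ^ (2 * r) * (N : ℕ) + 2 ^ (2 * r + 1) * k) := by
    exact_mod_cast hP
  have hpow : (-2 : ℤ) ^ (2 * r) = 2 ^ (2 * r) := Even.neg_pow ⟨r, two_mul r⟩ 2
  rw [hpow] at hZ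
  have hS : ∑ x ∈ {x : Fin ((3 * r + 2) + (3 * r + 2)) → Bool | ∀ i, x i = true → i ∈ Kᶜ}, u x = 4 * (N : ℤ) + 8 * k := by
    have e : (2 : ℤ) ^ (2 * r + 2) * ∑ x ∈ {x : Fin ((3 * r + 2) + (3 * r + 2)) → Bool | ∀ i, x i = true → i ∈ Kᶜ}, u x =
        2 ^ (2 * r + 2) * (4 * (N : ℤ) + 8 * k) := by
      rw [hZ, pow_succ, pow_succ]; ring
    exact mul_left_cancel₀ (by positivity) e
  obtain ⟨q, hq⟩ := f2_residual_cube_sum r g u hg hu t hH hL hflip Kᶜ hK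
  rw [hq] at hS
  have hEven : Even ((N : ℕ) : ℤ) := ⟨q - k, by omega⟩
  exact (Int.even_coe_nat _).1 hEven

/-- **The residual configuration is empty (`r ≥ 1`).** No cubic `g : 𝔽₂^{(3r+2)+(3r+2)} → 𝔽₂` with `W_g = 2^{2r+2}u` has a non-constant
parity `[u odd]` with `u ≡ 0 (mod 8)` off its support and `u ≡ ±1 (mod 8)` on it (in digits: `d₁ = d₂ = 0` where `u` is even, `d₂ = d₁` where
`u` is odd).  Uniform in `r`; NOT summit progress. [this work] -/
theorem f2_residual_false (hr : 1 ≤ r) (hg : IsDegLeFun 3 g)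
    (hu : ∀ x, W (fun y => signOf (g y)) x = (2 : ℝ) ^ (2 * r + 2) * (u x : ℝ))
    (hodd : ∃ x, Odd (u x)) (heven : ∃ x, ¬ Odd (u x))
    (hH : ∀ x, ¬ Odd (u x) → ¬ Odd (u x / 2) ∧ ¬ Odd (u x / 2 / 2))
    (hL : ∀ x, Odd (u x) → (Odd (u x / 2) ↔ Odd (u x / 2 / 2))) : False := by
  obtain ⟨p, hp, hrep⟩ := id hg
  obtain ⟨i, hflip⟩ := f2_exists_flip r g u hg hu hodd heven
  obtain ⟨m, rfl⟩ : ∃ m, r = m + 1 := ⟨r - 1, by omega⟩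
  set t : Fin ((3 * (m + 1) + 2) + (3 * (m + 1) + 2)) → Bool := fun j => decide (j = i) with htdef
  set K : Finset (Fin ((3 * (m + 1) + 2) + (3 * (m + 1) + 2))) := ({i} : Finset _)ᶜ with hKdef
  have hK3 : #K = 3 * (2 * m + 2 + 1) := by rw [hKdef, card_compl, Fintype.card_fin, card_singleton]; omega
  -- a pivot `j ≠ i`
  obtain ⟨j, hji⟩ : ∃ j : Fin ((3 * (m + 1) + 2) + (3 * (m + 1) + 2)), j ≠ i := by
    by_cases h0 : (⟨0, by omega⟩ : Fin ((3 * (m + 1) + 2) + (3 * (m + 1) + 2))) = i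
    · refine ⟨⟨1, by omega⟩, fun h => ?_⟩
      rw [← h0] at h
      exact absurd (congrArg Fin.val h) (by norm_num)
    · exact ⟨_, h0⟩
  have hjK : j ∈ K := by rw [hKdef, mem_compl, mem_singleton]; exact hji
  -- `N_{2r+1}(K)` is even: every `N_{2r}(K ∖ supp s₀)` is even
  have hNeven : Even #{S ∈ p.support.powerset | #S = 2 * m + 2 + 1 ∧ (S.biUnion fun s => s.support) = K} := by
    refine st_even_saturated_succ p hp K j hjK (2 * m + 2) hK3 fun s₀ hs₀ _ hs₀K hs₀3 => ?_
    have h := f2_residual_N_even (m + 1) g u hg hu p hp hrep t hH hL hflip (K \ s₀.support) ?_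
    · rw [show 2 * (m + 1) = 2 * m + 2 by ring] at h
      exact h
    have h1 : #(K \ s₀.support) = #K - #s₀.support := card_sdiff_of_subset hs₀K
    have h2 := card_compl (K \ s₀.support)
    rw [Fintype.card_fin] at h2
    omega
  -- `N_{2r+1}(K)` is odd: Poisson over `E_{{i}} = {0, e_i}`, where `u(0) + u(e_i)` is odd
  have hP := bb_poisson (fun y => signOf (g y)) ({i} : Finset (Fin ((3 * (m + 1) + 2) + (3 * (m + 1) + 2))))
  rw [sum_congr rfl fun x _ => hu x, ← mul_sum, card_singleton, ← hKdef, z2_bias_poly g p hrep K] at hP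
  obtain ⟨k₅, hk₅⟩ := st_cube_bias_congr p hp K (2 * m + 2 + 1) hK3
  rw [hk₅, f2_cube_singleton] at hP
  have hne : (zeroVec : Fin ((3 * (m + 1) + 2) + (3 * (m + 1) + 2)) → Bool) ≠ t := by
    intro h
    have := congrFun h i
    simp [zeroVec, htdef] at this
  rw [sum_pair hne] at hP
  set N := #{S ∈ p.support.powerset | #S = 2 * m + 2 + 1 ∧ (S.biUnion fun s => s.support) = K} with hN
  have hZ : (2 : ℤ) ^ (2 * (m + 1) + 2) * (u zeroVec + u t) =
      2 ^ 1 * ((-2) ^ (2 * m + 2 + 1) * (N : ℕ) + 2 ^ (2 * m + 2 + 1 + 1) * k₅) := by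
    exact_mod_cast hP
  have hpow : (-2 : ℤ) ^ (2 * m + 2 + 1) = -2 ^ (2 * m + 2 + 1) := Odd.neg_pow ⟨m + 1, by ring⟩ 2
  rw [hpow] at hZ
  -- cancel `2^{2r+2}`: `u(0) + u(e_i) = -N + 2k₅`
  have hS : u zeroVec + u t = -(N : ℤ) + 2 * k₅ := by
    have e : (2 : ℤ) ^ (2 * (m + 1) + 2) * (u zeroVec + u t) = 2 ^ (2 * (m + 1) + 2) * (-(N : ℤ) + 2 * k₅) := by
      rw [hZ]; ring
    exact mul_left_cancel₀ (by positivity) e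
  have hsumodd : Odd (u zeroVec + u t) := by
    have h0 := hflip zeroVec
    rw [BuzetChailloux.zeroVec_bxor] at h0
    rcases Int.even_or_odd (u zeroVec) with he | ho
    · exact Even.add_odd he (h0.2 (Int.not_odd_iff_even.2 he))
    · exact Odd.add_even ho (Int.not_odd_iff_even.1 (fun h => (h0.1 h) ho))
  obtain ⟨r', hr'⟩ := hNeven
  rw [hr'] at hS
  obtain ⟨s, hs⟩ := hsumodd
  rw [hs] at hS
  push_cast at hS
  omega

end Residual

end Summit.QuantumAdvantage.QuantumAdvantage.Theorems.CubicForrelation.NearExactIsExact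

end
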